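import Summits.CriticalPhenomena.PercolationContinuityZ3.Theorems.PercNearOneGluingNoHeavyRsw3AnnulusTwoArmFromBlocking
import HarnessLib

/-!
# RSW3 lane (P2, gen 10): TWO ARMS OR A NEAR-CERTAIN SPONGE CROSSING AT THE SAME SCALE —
# `σ₂(n)² · P_p((boxCross (easyShape 2 (2n)) 0)ᶜ) ≤ α₂(n, 2n)` for every `p` and every `n ≥ 1`;
# `BlockingLowerBound (easyShape 2) 0 → AnnulusTwoArmLowerBound`

builds on p205010 (kernel theorem, internal audit signed; external expert review pending)

Cell `prim-rsw3`, prover seat `prim-rsw3-p2` (gen 10), memo `run/shared/lean/prim/rsw3/P2-RSWLITE.md` §16.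
Support file (`--supports stmt-CriticalPhenomena-4575`); no definitions, no named facts, no sorries.

Notation: `Λ(N) = box 3 N`, `α₂(m, N) = Crossing.annulusTwoArmProb 3 p m N = P_p((uniqZone m N)ᶜ)`,
`σ₂(n) = P_p(boxCross (easyShape 2 n) 0)` (`{0..n} × {0..2n}²` crossed the thin way).

MAIN INEQUALITY (`sq_mul_real_compl_boxCross_le_annulusTwoArmProb`).  For every `p` and every `n ≥ 1`:

  `σ₂(n)² · P_p((boxCross (easyShape 2 (2n)) 0)ᶜ) ≤ α₂(n, 2n)`.

The block `{0..2n} × {0..4n}²` of shape `easyShape 2 (2n)` is a translate of the middle layer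
`M = [-n, n] × [-2n, 2n]²` of `Λ(2n)`.  Gen 9's `sq_mul_real_le_annulusTwoArmProb` accepts any middle-layer event `W`
that is determined by edges having an endpoint STRICTLY between the planes `{x₀ = ±n}` and on which no open path of
`Λ(2n)` joins the two planes.  The plain seal of `M` ("no open `0`-crossing of `M`") does not qualify (it reads the
edges inside the two planes, which the radial slabs also use), but the EDGE-RESTRICTED seal
`W'' = {ω | ω ∩ T ∉ X}` does, where `T = {e | some endpoint has |x₀| < n}` and `X` = "`M` is `0`-crossed":
(a) `W''` is determined by `T` (tautologically) and measurable; (b) a plane-to-plane open path inside `Λ(2n)`, cut down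
to the segment between its LAST visit to `{x₀ = -n}` before its FIRST visit to `{x₀ = n}`, has all its intermediate
vertices strictly between the planes (discrete intermediate values), so each of its edges lies in `T`, and it runs
inside `M`; hence `ω ∩ T ∈ X` — excluded on `W''`; (c) `X` is increasing, so `Xᶜ ⊆ W''` and
`P_p(W'') ≥ 1 - P_p(X) ≥ 1 - σ_p(easyShape 2 (2n))` (`real_linked_le_real_boxCross`).  Compared with gen 9's wall of `81`
blocked aspect-2 annuli (`sq_mul_blocking_pow_le_annulusTwoArmProb`, `n ≥ 3`) the blocking factor is ONE sponge
blocking probability at the same scale, valid from `n = 1`.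

CONSEQUENCES.  `exists_mul_real_compl_boxCross_le_annulusTwoArmProb_criticalProbI` (unconditional at `p_c(ℤ³)`:
`c · (1 - σ_{p_c}(easyShape 2 (2n))) ≤ α₂(n,2n)`, `c` = square of the `EasyCrossingLowerBound 2` constant — at every
scale, two arms OR the aspect-2 sponge block is crossed with probability `≥ 1 - α₂(n,2n)/c`);
`annulusTwoArmLowerBound_of_blockingLowerBound_easyShape_two` (`BlockingLowerBound (easyShape 2) 0 → AnnulusTwoArmLowerBound`).
DICTIONARY (companion file `…Rsw3EasyBlockingDictionary`, `Rsw3.critAnnulusNonCrossing_iff_blockingLowerBound_easyShape_two`):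
the route node `X_B = CritAnnulusNonCrossing` (aspect-2 annulus blocking at `p_c`) is EQUIVALENT to
`BlockingLowerBound (easyShape 2) 0` (tree stubs `stub_tiling` + `stub_sixSlab` one way, the inclusion "a thin-way crossing
of `[n,2n] × [-n,n]²` crosses the annulus" the other way); so gen 9's `X_B ⇒ AnnulusTwoArmLowerBound` and the present easy₂
form have the same strength — the gain here is the every-`p`, every-`n` inequality with blocking factor ONE sponge
probability at the same scale (constant `1` instead of `^81`, and `^169·6` hidden in `X_B ⇐ easy₂`).

HONEST PLACEMENT.  Elementary (first/last visit, independence on disjoint edge classes via gen 9, Harris, translation);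
the content is the observation that edge-restricted seals are admissible walls and are dominated by plain seals.
Nothing is uniform at `p_c` unconditionally.

References: M. Aizenman, Nucl. Phys. B 485 (1997) 551–582, §2 Thm. 2 / Remark 2 [Aizenman1997]; H. Kesten,
*Percolation Theory for Mathematicians* (1982), §3.3 and Thm. 5.1 (sponge crossings) [Kesten1982]; G. Grimmett,
*Percolation* (1999), §1.3, Thm. (2.4), §7.3 p. 164 (paths "in `V*`" using no boundary edge) [GrimmettPercolation1999];
C. Borgs, J. Chayes, H. Kesten, J. Spencer, Random Structures Algorithms 15 (1999) 368–413, §1 [BorgsChayesKestenSpencer1999].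
[folklore]
-/

noncomputable section

namespace Summit.CriticalPhenomena.PercolationContinuityZ3.Theorems

open MeasureTheory ProbabilityTheory Filter Topology
open Literature.Probability.Percolation Literature.Probability.LatticeModels
open Literature.Barriers.CriticalPhenomena

namespace Rsw3

open SurfaceTension Crossing

variable {d : ℕ}

/-! ## Discrete intermediate values along a lattice walk (index form) -/

/-- **Discrete intermediate value theorem along a walk, index form.**  For a walk `W` in a subgraph `H ≤ ℤ^d`
and indices `r ≤ r + k ≤ W.length` with `(W.getVert r) i ≤ ℓ ≤ (W.getVert (r+k)) i`, some intermediate vertex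
`W.getVert (r+j)`, `j ≤ k`, has `i`-th coordinate exactly `ℓ` (steps change a coordinate by at most one). [folklore] -/
theorem exists_getVert_apply_eq {H : SimpleGraph (Site d)} (hH : H ≤ zdGraph d) {a b : Site d}
    (W : H.Walk a b) (i : Fin d) (ℓ : ℤ) (r : ℕ) :
    ∀ k : ℕ, r + k ≤ W.length → W.getVert r i ≤ ℓ → ℓ ≤ W.getVert (r + k) i →
      ∃ j : ℕ, j ≤ k ∧ W.getVert (r + j) i = ℓ := by
  intro k
  induction k with
  | zero =>
    intro _ hr hrk
    exact ⟨0, le_rfl, le_antisymm (by simpa using hr) (by simpa using hrk)⟩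
  | succ k ih =>
    intro hk hr hrk
    by_cases hle : ℓ ≤ W.getVert (r + k) i
    · obtain ⟨j, hj, hjℓ⟩ := ih (by omega) hr hle
      exact ⟨j, by omega, hjℓ⟩
    · push Not at hle
      have hadj : H.Adj (W.getVert (r + k)) (W.getVert (r + k + 1)) := W.adj_getVert_succ (by omega)
      have h1 := (coord_sub_le_one_of_adj (hH hadj) i).2
      refine ⟨k + 1, le_rfl, ?_⟩
      rw [← add_assoc]
      have : W.getVert (r + (k + 1)) i = W.getVert (r + k + 1) i := by rw [← add_assoc]
      rw [this] at hrk
      omega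

/-! ## The edge-restricted seal of the middle layer is an admissible wall -/

/-- **`σ₂(n)² · P_p((boxCross (easyShape 2 (2n)) 0)ᶜ) ≤ α₂(n, 2n)` for every `p` and every `n ≥ 1`.**
Two easy radial crossings of the aspect-2 annulus `Λ(2n) ∖ Λ(n)` separated by the middle layer
`[-n,n] × [-2n,2n]²` (a translate of the block `{0..2n} × {0..4n}²` of shape `easyShape 2 (2n)`) sealed for the
paths that use only edges with an endpoint strictly between the planes `{x₀ = ±n}`; the edge-restricted seal is
an admissible middle-layer event for `sq_mul_real_le_annulusTwoArmProb` (determined by that edge class; every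
plane-to-plane path contains a sub-path in that class, by last/first visits) and contains the plain seal
(crossing events are increasing), whose probability is `1 - σ_p(easyShape 2 (2n))` by translation invariance.
[folklore] -/
theorem sq_mul_real_compl_boxCross_le_annulusTwoArmProb (p : unitInterval) {n : ℕ} (hn : 1 ≤ n) :
    (bondPercolation (zdGraph 3) p).real (boxCross (easyShape 2 n) 0) ^ 2 *
        (bondPercolation (zdGraph 3) p).real (boxCross (easyShape 2 (2 * n)) 0)ᶜ ≤
      annulusTwoArmProb 3 p n (2 * n) := by
  classical
  set μ := bondPercolation (zdGraph 3) p with hμ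
  -- the middle layer `R = v + {0..M}`, `v = (-n, -2n, -2n)`, `M = easyShape 2 (2n) = (2n, 4n, 4n)`
  set M : Site 3 := easyShape 2 (2 * n) with hM
  set v : Site 3 := ![-(n : ℤ), -(2 * (n : ℤ)), -(2 * (n : ℤ))] with hv
  have hM0 : M 0 = 2 * (n : ℤ) := by simp [hM, easyShape]
  have hMj : ∀ j : Fin 3, j ≠ 0 → M j = 4 * (n : ℤ) := by
    intro j hj; fin_cases j <;> simp [hM, easyShape] at hj ⊢ <;> ring
  have hv0 : v 0 = -(n : ℤ) := by simp [hv]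
  have hvj : ∀ j : Fin 3, j ≠ 0 → v j = -(2 * (n : ℤ)) := by
    intro j hj; fin_cases j <;> simp [hv] at hj ⊢
  set R : Set (Site 3) := {x | ∀ j, v j ≤ x j ∧ x j ≤ v j + M j} with hR
  set A : Set (Site 3) := {x | x ∈ R ∧ x 0 = v 0} with hA
  set B : Set (Site 3) := {x | x 0 = v 0 + M 0} with hB
  set X : Set (BondConfig (Site 3)) := linked R A B with hX
  -- the admissible edge class and the edge-restricted seal
  set T : Set (Sym2 (Site 3)) := {e | ∃ x ∈ e, |x 0| < (n : ℤ)} with hT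
  set W : Set (BondConfig (Site 3)) := {ω | ω ∩ T ∉ X} with hW
  have hWT : DeterminedBy W T := by
    rw [determinedBy_iff]
    intro ω ω' h
    simp only [hW, Set.mem_setOf_eq, h]
  have hmeas : Measurable fun ω : BondConfig (Site 3) => ω ∩ T :=
    measurable_set_iff.2 fun e => (measurable_set_mem e).and measurable_const
  have hXm : MeasurableSet X := measurableSet_linked R A B
  have hWm : MeasurableSet W := by
    have : W = (fun ω : BondConfig (Site 3) => ω ∩ T) ⁻¹' Xᶜ := rfl
    rw [this]
    exact hXm.compl.preimage hmeas
  have hTn : ∀ e ∈ T, ∃ x ∈ e, |x 0| < (n : ℤ) := fun e he => he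
  -- membership in `R` from the coordinate bounds
  have hmemR : ∀ x : Site 3, -(n : ℤ) ≤ x 0 → x 0 ≤ n → x ∈ box 3 (2 * n) → x ∈ R := by
    intro x h1 h2 hx
    rw [mem_box] at hx
    intro j
    by_cases hj : j = 0
    · subst hj; rw [hv0, hM0]; omega
    · rw [hvj j hj, hMj j hj]; have := hx j; push_cast at this; omega
  -- (b) the kill property
  have hkill : ∀ ω, ω ⊆ (zdGraph 3).edgeSet → ω ∈ W → ∀ a b : Site 3, a 0 = -(n : ℤ) → b 0 = n →
      ¬ (openGraph ω ⊓ withinGraph (zdGraph 3) (↑(box 3 (2 * n)) : Set (Site 3))).Reachable a b := by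
    intro ω _ hWω a b ha hb hab
    apply hWω
    -- the walk and the graph
    set H := openGraph ω ⊓ withinGraph (zdGraph 3) (↑(box 3 (2 * n)) : Set (Site 3)) with hH
    have hHle : H ≤ zdGraph 3 := fun x y hxy => (withinGraph_adj.1 hxy.2).1
    obtain ⟨Wk⟩ := hab
    -- `s` = first index with `x₀ = n`
    have hex_s : ∃ s : ℕ, Wk.getVert s 0 = n := ⟨Wk.length, by rw [Wk.getVert_length, hb]⟩
    set s := Nat.find hex_s with hs
    have hs_eq : Wk.getVert s 0 = n := Nat.find_spec hex_s
    have hs_len : s ≤ Wk.length := Nat.find_min' hex_s (by rw [Wk.getVert_length, hb])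
    have hs_ne : ∀ r, r < s → Wk.getVert r 0 ≠ n := fun r hr => Nat.find_min hex_s hr
    have hs_lt : ∀ r, r < s → Wk.getVert r 0 < n := by
      intro r hr
      by_contra hge
      push Not at hge
      -- IVT on `[0, r]`: `x₀(0) = -n ≤ n ≤ x₀(r)`
      obtain ⟨j, hj, hjn⟩ := exists_getVert_apply_eq hHle Wk 0 (n : ℤ) 0 r (by omega)
        (by rw [Wk.getVert_zero, ha]; omega) (by rw [zero_add]; exact hge)
      rw [zero_add] at hjn
      exact hs_ne j (by omega) hjn
    -- `t` = last index `≤ s` with `x₀ = -n`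
    set t := Nat.findGreatest (fun r => Wk.getVert r 0 = -(n : ℤ)) s with ht
    have ht_eq : Wk.getVert t 0 = -(n : ℤ) :=
      Nat.findGreatest_spec (P := fun r => Wk.getVert r 0 = -(n : ℤ)) (Nat.zero_le s)
        (by rw [Wk.getVert_zero, ha])
    have ht_le : t ≤ s := Nat.findGreatest_le s
    have ht_lt : t < s := by
      rcases ht_le.lt_or_eq with h | h
      · exact h
      · exfalso; rw [← h, ht_eq] at hs_eq; omega
    have ht_max : ∀ r, t < r → r ≤ s → Wk.getVert r 0 ≠ -(n : ℤ) := fun r hr hrs =>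
      Nat.findGreatest_is_greatest hr hrs
    have ht_gt : ∀ r, t < r → r ≤ s → -(n : ℤ) < Wk.getVert r 0 := by
      intro r hr hrs
      by_contra hge
      push Not at hge
      -- IVT on `[r, s]`: `x₀(r) ≤ -n ≤ n = x₀(s)`
      obtain ⟨j, hj, hjn⟩ := exists_getVert_apply_eq hHle Wk 0 (-(n : ℤ)) r (s - r) (by omega) hge
        (by rw [Nat.add_sub_cancel' hrs, hs_eq]; omega)
      exact ht_max (r + j) (by omega) (by omega) hjn
    -- every vertex with index in `[t, s]` lies in `R`; membership in `Λ(2n)` from the walk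
    have hmem_box : ∀ r, r ≤ Wk.length → 0 < Wk.length → Wk.getVert r ∈ box 3 (2 * n) := by
      intro r hr hpos
      rcases Nat.lt_or_ge r Wk.length with hlt | hge
      · have hadj := Wk.adj_getVert_succ hlt
        exact Finset.mem_coe.1 (withinGraph_adj.1 hadj.2).2.1
      · have hr' : r = Wk.length := le_antisymm hr hge
        obtain ⟨l, hl⟩ : ∃ l, Wk.length = l + 1 := ⟨Wk.length - 1, by omega⟩
        have hadj := Wk.adj_getVert_succ (i := l) (by omega)
        rw [← hl] at hadj
        rw [hr']
        exact Finset.mem_coe.1 (withinGraph_adj.1 hadj.2).2.2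
    have hlen_pos : 0 < Wk.length := by
      by_contra h0
      push Not at h0
      have h0' : Wk.length = 0 := by omega
      have := hs_len
      rw [h0'] at this
      have hs0 : s = 0 := by omega
      rw [hs0, Wk.getVert_zero, ha] at hs_eq
      omega
    have hR_of : ∀ r, t ≤ r → r ≤ s → Wk.getVert r ∈ R := by
      intro r htr hrs
      refine hmemR _ ?_ ?_ (hmem_box r (hrs.trans hs_len) hlen_pos)
      · rcases htr.lt_or_eq with h | h
        · exact (ht_gt r h hrs).le
        · rw [← h, ht_eq]
      · rcases hrs.lt_or_eq with h | h
        · exact (hs_lt r h).le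
        · rw [h, hs_eq]
    -- adjacency in the restricted graph along `[t, s]`
    set H' := openGraph (ω ∩ T) ⊓ withinGraph (zdGraph 3) R with hH'
    have hadj' : ∀ r, t ≤ r → r < s → H'.Adj (Wk.getVert r) (Wk.getVert (r + 1)) := by
      intro r htr hrs
      have hadj := Wk.adj_getVert_succ (i := r) (by omega)
      obtain ⟨hopen, hwithin⟩ := (SimpleGraph.inf_adj _ _ _ _).1 hadj
      rw [withinGraph_adj] at hwithin
      obtain ⟨he, hne⟩ := (openGraph_adj ω _ _).1 hopen
      -- some endpoint strictly between the planes
      have hTmem : s(Wk.getVert r, Wk.getVert (r + 1)) ∈ T := by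
        rcases htr.lt_or_eq with h | h
        · exact ⟨Wk.getVert r, Sym2.mem_mk_left _ _,
            abs_lt.2 ⟨ht_gt r h (by omega), hs_lt r hrs⟩⟩
        · -- `r = t`: the next vertex is strictly inside, since `t + 1 < s`
          have h2 : t + 1 < s := by
            by_contra hle
            push Not at hle
            have hts : s = t + 1 := by omega
            have h1 := (coord_sub_le_one_of_adj hwithin.1 0).2
            have e1 : Wk.getVert r 0 = -(n : ℤ) := by rw [← h]; exact ht_eq
            have e2 : Wk.getVert (r + 1) 0 = n := by
              have e := hs_eq
              rw [hts, h] at e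
              exact e
            have h1n : (1 : ℤ) ≤ n := by exact_mod_cast hn
            omega
          refine ⟨Wk.getVert (r + 1), Sym2.mem_mk_right _ _, abs_lt.2 ⟨?_, ?_⟩⟩
          · exact ht_gt (r + 1) (by omega) (by omega)
          · exact hs_lt (r + 1) (by omega)
      refine (SimpleGraph.inf_adj _ _ _ _).2 ⟨(openGraph_adj _ _ _).2 ⟨⟨he, hTmem⟩, hne⟩, ?_⟩
      rw [withinGraph_adj]
      exact ⟨hwithin.1, hR_of r htr (by omega), hR_of (r + 1) (by omega) (by omega)⟩
    have hreach : ∀ k, t + k ≤ s → H'.Reachable (Wk.getVert t) (Wk.getVert (t + k)) := by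
      intro k
      induction k with
      | zero => intro _; exact SimpleGraph.Reachable.refl _
      | succ k ih =>
        intro hk
        have h1 := ih (by omega)
        have h2 := (hadj' (t + k) (by omega) (by omega)).reachable
        rw [← add_assoc]
        exact h1.trans h2
    have hts : H'.Reachable (Wk.getVert t) (Wk.getVert s) := by
      have := hreach (s - t) (by omega)
      rwa [Nat.add_sub_cancel' ht_le] at this
    -- conclude: `ω ∩ T ∈ X`
    rw [hX, mem_linked_iff]
    refine ⟨Wk.getVert t, ⟨hR_of t le_rfl ht_le, by rw [ht_eq, hv0]⟩, Wk.getVert s,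
      by show Wk.getVert s 0 = v 0 + M 0; rw [hs_eq, hv0, hM0]; ring, ?_⟩
    rw [mem_inConn_iff]
    exact hts
  -- gen 9's inequality with this wall
  have hmain := sq_mul_real_le_annulusTwoArmProb p hn hWT hWm hTn hkill
  -- (c) `P(W) ≥ 1 - P(X) ≥ P((boxCross (easyShape 2 (2n)) 0)ᶜ)`
  have hXW : Xᶜ ⊆ W := by
    intro ω hω hωT
    exact hω (isUpperSet_linked R A B (Set.inter_subset_left : ω ∩ T ⊆ ω) hωT)
  have hM0' : (0 : ℤ) ≤ M 0 := by rw [hM0]; positivity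
  have hXle : μ.real X ≤ μ.real (boxCross M 0) :=
    real_linked_le_real_boxCross p (R := R) (A := A) (B := B) (v := v) (M := M) (L := M) 0
      (fun x hx => hx) (fun x hx => hx.1) (fun x hx => hx.2) (fun x hx => hx) hM0' le_rfl (fun j _ => le_rfl)
  have hXc : μ.real Xᶜ = 1 - μ.real X := probReal_compl_eq_one_sub hXm
  have hBc : μ.real (boxCross M 0)ᶜ = 1 - μ.real (boxCross M 0) :=
    probReal_compl_eq_one_sub (measurableSet_boxCross M 0)
  have hXW' : μ.real Xᶜ ≤ μ.real W := measureReal_mono hXW (measure_ne_top μ W)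
  have hcompl : μ.real (boxCross M 0)ᶜ ≤ μ.real W := by
    rw [hBc]; rw [hXc] at hXW'; linarith
  have h0 : 0 ≤ μ.real (boxCross (easyShape 2 n) 0) ^ 2 := pow_nonneg measureReal_nonneg 2
  exact (mul_le_mul_of_nonneg_left hcompl h0).trans hmain

/-! ## At `p_c(ℤ³)`: the sponge dichotomy, and `BlockingLowerBound (easyShape 2) 0 → AnnulusTwoArmLowerBound` -/

/-- **TWO ARMS OR A NEAR-CERTAIN SPONGE CROSSING, at `p_c(ℤ³)`, unconditional:** there is `c > 0` (the square of the
`EasyCrossingLowerBound 2` constant) with `c · (1 - σ_{p_c}(easyShape 2 (2n))) ≤ α₂(n, 2n)` for every `n ≥ 1`: at every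
scale, either the aspect-2 two-arm probability is `≥ c ε`, or the aspect-2 sponge block `{0..2n} × {0..4n}²` is crossed
the thin way with probability `≥ 1 - ε`.
builds on p205010 (kernel theorem, internal audit signed; external expert review pending). [folklore] -/
theorem exists_mul_real_compl_boxCross_le_annulusTwoArmProb_criticalProbI :
    ∃ c : ℝ, 0 < c ∧ ∀ n : ℕ, 1 ≤ n →
      c * (bondPercolation (zdGraph 3) (criticalProbI 3)).real (boxCross (easyShape 2 (2 * n)) 0)ᶜ ≤
        annulusTwoArmProb 3 (criticalProbI 3) n (2 * n) := by
  obtain ⟨cE, hcE, hE⟩ := easyCrossingLowerBound_two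
  refine ⟨cE ^ 2, by positivity, fun n hn => ?_⟩
  have hσ : cE ^ 2 ≤ (bondPercolation (zdGraph 3) (criticalProbI 3)).real (boxCross (easyShape 2 n) 0) ^ 2 :=
    pow_le_pow_left₀ hcE.le (hE n hn) 2
  exact (mul_le_mul_of_nonneg_right hσ measureReal_nonneg).trans
    (sq_mul_real_compl_boxCross_le_annulusTwoArmProb (criticalProbI 3) hn)

/-- **`BlockingLowerBound (easyShape 2) 0 → AnnulusTwoArmLowerBound`.**  If at `p_c(ℤ³)` the blocks `{0..n} × {0..2n}²` fail
to be crossed the thin way with probability `≥ c_B` for every `n ≥ 1` (Kesten-type sponge blocking at aspect `2`; by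
`Rsw3.critAnnulusNonCrossing_iff_blockingLowerBound_easyShape_two` of the companion dictionary file this is the route
node `X_B`), then
`c_E² · c_B ≤ α₂(n, 2n)` for every `n ≥ 1` (`Crossing.AnnulusTwoArmLowerBound`, LADDER R3.2).
builds on p205010 (kernel theorem, internal audit signed; external expert review pending). [folklore] -/
theorem annulusTwoArmLowerBound_of_blockingLowerBound_easyShape_two (hB : BlockingLowerBound (easyShape 2) 0) :
    AnnulusTwoArmLowerBound := by
  obtain ⟨cB, hcB, hB'⟩ := hB
  obtain ⟨c, hc, h⟩ := exists_mul_real_compl_boxCross_le_annulusTwoArmProb_criticalProbI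
  refine ⟨c * cB, mul_pos hc hcB, fun n hn => ?_⟩
  exact (mul_le_mul_of_nonneg_left (hB' (2 * n) (by omega)) hc.le).trans (h n hn)

end Rsw3

end Summit.CriticalPhenomena.PercolationContinuityZ3.Theorems

end
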